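import Summits.SmoothPoincare4.SmoothPoincare4.Theses.CongruenceShadows
import Summits.SmoothPoincare4.SmoothPoincare4.Theorems.ShadowApproximation.Negative.ShadowsOnlyFalse
import HarnessLib
import HarnessLib.Audit

/-!
# Line `nilpotent-genus-class` for crux `CongruenceShadows.ShadowApproximation` (stmt-SmoothPoincare4-14595)

Skeleton (crux-plan, round 1, idea `nilpotent-genus-class`, triage r1-2: pass, r1-3: pass, with
their sharpenings): **genus versus class in the nilpotent tower.** Truncate the approximation
problem modulo `γ_{c+2} S` (`γ m c := (⊤ : Subgroup S).lowerCentralSeries (c+1)`, so `γ m 0 = [S,S]`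
is the ABELIAN level — the indexing of the route's `NilpotentShadowsStandard`, fixing the off-by-one
flagged by triage r1-3). At each level the image `Γ_c` of `Aut S` in `Aut (S/γ_{c+2}S)` is an
arithmetic group, the standard-shadow hypothesis `hS` says that the level-`c` shadow of `K` lies in
the GENUS of the standard one (an element of the congruence closure of `Γ_c` carries one to the
other), and "genus = class" is a class-number-one / `H¹`-vanishing statement for the triple
stabiliser `𝕊_c` — with the Waldhausen pair `(N 0, N 1)` kept EXACT throughout (solutions are
sought in the Goeritz group `A ∩ B = Stab_{Aut S}(N 0, N 1)`), slot `2` standard modulo `γ`.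

Notation (all existing declarations): `S m = SurfaceGroup (3+3m)`, `N m = s4Kernels.stabilizeIter m`
(the standard `(3+3m; m+1)` triple of `S⁴`), `γ m c` as above, `Pairs` / `Shadows` = the crux's
own hypotheses `hW` / `hS` read back (as in `Cruxes/…/Disproof.lean` §0).

Chain (each arrow a registered stub; all glue proved in this file, sorries ONLY inside `stub_*`):

  crux hypotheses for `K` —[proved: slot-normalisation by `hW 0 1`, transport of every hypothesis
  and of the conclusion along `Aut S`]→ WLOG `K 0 = N 0`, `K 1 = N 1`
  —[ABELIAN LEVEL = Stub 1 `stub_abelianGenusClass` (ArithGate₀: genus = class for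
     `𝕊₀ = GL_k³ ⋉ U`, Hilbert 90 + `h_ℚ = 1` + strong approximation; consumes `hS` at the levels
     `[S,S]·Sⁿ`) + Stub 2 `stub_goeritzAbelianImage` (GS₀: the Goeritz group of the standard
     genus-`3k` splitting of `#ᵏ S¹×S²` realises every element of `im (Aut S)` stabilising the two
     Lagrangians `L₀, L₁`)]→ `x₀ ∈ A∩B` with `x₀(N 2)·[S,S] = K 2·[S,S]`
  —[LAYER STEP = Stub 3 `stub_nilpotentLayerStep` (ArithGate_{c+1} ∧ GS_{c+1} on the fibre over the
     standard level-`c` triple: the `H¹` / class-number computation for `𝕊_{c+1} → 𝕊_c` in the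
     Johnson–Morita layer `γ_{c+2}/γ_{c+3}`), iterated — the induction `levelSolution_all` is proved
     here]→ for every `c` some `x_c ∈ A∩B` with `x_c(N 2)·γ_{c+2} = K 2·γ_{c+2}`
  —[`c → ∞` = Stub 4 `stub_johnsonClosedGate` (the honest residual: the `(A∩B)`-orbit of `N 2` is
     closed in the JOHNSON topology on the gate locus; integral Mittag-Leffler for the tower of
     level-`c` trisection groups)]→ `Iso N K`.

`ShadowApproximation_of : …CongruenceShadows.ShadowApproximation` is proved at the end from the four
stubs with NO hypotheses; `iso_of_parts` is the same composition with the four statements as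
explicit hypotheses (pure logic, kernel-checked).

Disproof.lean (cdisprove gen 1 v3) honoured: §3 `shadowApproximation_false_without_isGroupTrisection`
— `IsGroupTrisection` (with `Pairs`) is an explicit hypothesis of Stubs 1, 3, 4, and it is USED at
Stub 4: the landed junk triple `J = (N₀, N₁, N₂ ⊓ ker θ)` (`Negative/ShadowsOnlyFalse.lean`, imported)
has standard NILPOTENT shadows at every level with `x_c = id ∈ A∩B` (`N₂/J₂ ≅ θ(N₂)` is perfect, so
`N₂ ≤ J₂·γ_c S` for all `c` — certificate `junk_levelSolution` below, sorry-free) yet `¬ Iso N J`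
(`not_iso_junk`): so `JohnsonClosedGate` with `IsGroupTrisection ∧ Pairs` dropped is FALSE
(`johnsonClosedGate_false_without_isGroupTrisection`, proved here) — any proof of Stub 4 must use
`free_quotient 2` / `free_pairQuotient 0 2` (the fields `ShadowsOnlyFalseFields` shows `J` violates).
§2 sandwich respected: on the load path the crux is `UnstableGate_g`; Stubs 1–3 are strictly weaker
than the crux (implied by it: take `x := the Iso`) and consume `hS`; Stub 4 carries the 4-d depth.
`ledger negatives --problem SmoothPoincare4` = 0 (2026-08-16): no stub restates a refuted statement.
-/

noncomputable section

set_option linter.dupNamespace false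

open Literature.Topology.FourManifolds
open Summit.SmoothPoincare4.SmoothPoincare4.Theses.CongruenceShadows

namespace Summit.SmoothPoincare4.SmoothPoincare4.Cruxes.ShadowApproximation.NilpotentGenusClass

/-! ## 0. Notation and sorry-free transport lemmas -/

/-- `S_g` at the crux's genus `g = 3 + 3m`. -/
abbrev S (m : ℕ) : Type := SurfaceGroup (3 + 3 * m)

/-- The standard kernel triple `N = s4Kernels # … # s4Kernels` of genus `3 + 3m`. -/
abbrev N (m : ℕ) : TrisectionKernels (3 + 3 * m) := s4Kernels.stabilizeIter m

/-- `γ m c = γ_{c+2}(S)` (1-indexed lower central series): `(⊤).lowerCentralSeries (c+1)`;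
`γ m 0 = [S,S]` is the abelian level, `γ m 1 = [[S,S],S]` the 2-step level, … — the SAME indexing
as the route's `NilpotentShadowsStandard` (triage r1-3 sharpening). -/
abbrev γ (m c : ℕ) : Subgroup (S m) := (⊤ : Subgroup (S m)).lowerCentralSeries (c + 1)

/-- The crux's Waldhausen normalisation `hW`: each pair of slots simultaneously standard. -/
def Pairs (m : ℕ) (K : TrisectionKernels (3 + 3 * m)) : Prop :=
  ∀ i j : Fin 3, i ≠ j → ∃ α : S m ≃* S m,
    (N m i).map α.toMonoidHom = K i ∧ (N m j).map α.toMonoidHom = K j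

/-- The crux's shadow hypothesis `hS`: standard shadows in every characteristic finite quotient. -/
def Shadows (m : ℕ) (K : TrisectionKernels (3 + 3 * m)) : Prop :=
  ∀ M : Subgroup (S m), M.Characteristic → M.FiniteIndex →
    ∃ ψ : S m ≃* S m, ∀ i : Fin 3, (N m i ⊔ M).map ψ.toMonoidHom = K i ⊔ M

/-- A LEVEL-`c` SOLUTION for a slot-normalised `K`: a Goeritz element `x ∈ A∩B`
(`x(N 0) = N 0`, `x(N 1) = N 1`) carrying `N 2` onto `K 2` modulo `γ_{c+2}`. -/
def LevelSolution (m c : ℕ) (K : TrisectionKernels (3 + 3 * m)) : Prop :=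
  ∃ x : S m ≃* S m, (N m 0).map x.toMonoidHom = N m 0 ∧ (N m 1).map x.toMonoidHom = N m 1 ∧
    (N m 2 ⊔ γ m c).map x.toMonoidHom = K 2 ⊔ γ m c

/-- READ-BACK: the crux is literally `∀ m K, IsGroupTrisection → Pairs → Shadows → Iso N K`. -/
theorem shadowApproximation_iff :
    ShadowApproximation ↔ ∀ (m : ℕ) (K : TrisectionKernels (3 + 3 * m)),
      IsGroupTrisection (3 + 3 * m) (m + 1) (PUnit : Type) K → Pairs m K → Shadows m K →
        TrisectionKernels.Iso (N m) K :=
  Iff.rfl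

section transport

variable {G : Type*} [Group G]

/-- `H ↦ H.map` along a composite of automorphisms. -/
theorem map_trans (e₁ e₂ : G ≃* G) (H : Subgroup G) :
    H.map (e₁.trans e₂).toMonoidHom = (H.map e₁.toMonoidHom).map e₂.toMonoidHom := by
  rw [Subgroup.map_map]
  rfl

/-- `e⁻¹` undoes `e` on subgroups. -/
theorem map_map_symm (e : G ≃* G) (H : Subgroup G) :
    (H.map e.toMonoidHom).map e.symm.toMonoidHom = H := by
  ext x
  simp

/-- `e` undoes `e⁻¹` on subgroups. -/
theorem map_symm_map (e : G ≃* G) (H : Subgroup G) :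
    (H.map e.symm.toMonoidHom).map e.toMonoidHom = H := by
  ext x
  simp

/-- If `e(H) = K` then `e⁻¹(K) = H`. -/
theorem map_symm_of_map (e : G ≃* G) {H K : Subgroup G} (h : H.map e.toMonoidHom = K) :
    K.map e.symm.toMonoidHom = H := by
  rw [← h, map_map_symm]

/-- An automorphism maps `⊤` onto `⊤`. -/
theorem map_top_equiv (ψ : G ≃* G) : (⊤ : Subgroup G).map ψ.toMonoidHom = ⊤ := by
  rw [← MonoidHom.range_eq_map, MonoidHom.range_eq_top.2 ψ.surjective]

/-- The lower central series is invariant under automorphisms (`map_lowerCentralSeries`). -/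
theorem map_lcs_equiv (ψ : G ≃* G) (n : ℕ) :
    ((⊤ : Subgroup G).lowerCentralSeries n).map ψ.toMonoidHom = (⊤ : Subgroup G).lowerCentralSeries n := by
  rw [Subgroup.map_lowerCentralSeries, map_top_equiv]

/-- CONGRUENCE ⟹ EQUAL IMAGES MODULO `M`: if `x ≡ φ (mod M)` pointwise (`x s · (φ s)⁻¹ ∈ M`), then
`x(H)·M ⊆ φ(H)·M` (`x h = (x h (φ h)⁻¹) · φ h`). -/
theorem map_le_of_congr {M : Subgroup G} {x φ : G ≃* G} (h : ∀ s, x s * (φ s)⁻¹ ∈ M)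
    (H : Subgroup G) : H.map x.toMonoidHom ≤ H.map φ.toMonoidHom ⊔ M := by
  rintro _ ⟨s, hs, rfl⟩
  have e : x.toMonoidHom s = (x s * (φ s)⁻¹) * φ.toMonoidHom s := by simp
  rw [e, sup_comm]
  exact Subgroup.mul_mem_sup (h s) (Subgroup.mem_map_of_mem _ hs)

/-- … hence `x(H)·M = φ(H)·M`. -/
theorem map_sup_congr {M : Subgroup G} {x φ : G ≃* G} (h : ∀ s, x s * (φ s)⁻¹ ∈ M)
    (H : Subgroup G) : H.map x.toMonoidHom ⊔ M = H.map φ.toMonoidHom ⊔ M :=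
  le_antisymm (sup_le (map_le_of_congr h H) le_sup_right)
    (sup_le (map_le_of_congr (fun s => by simpa using M.inv_mem (h s)) H) le_sup_right)

end transport

/-- `γ` is `Aut S`-invariant. -/
theorem map_γ (m c : ℕ) (ψ : S m ≃* S m) : (γ m c).map ψ.toMonoidHom = γ m c :=
  map_lcs_equiv ψ (c + 1)

variable {g : ℕ}

/-- **`Aut S_g`-invariance of the group-trisection property** (Abrams–Gay–Kirby: isomorphic kernel
triples have isomorphic cubes of quotients): each of the seven quotients of `α • K` is isomorphic
to the corresponding quotient of `K` via `QuotientGroup.congr`. -/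
theorem isGroupTrisection_map {k : ℕ} {G : Type*} [Group G] {K : TrisectionKernels g}
    (hK : IsGroupTrisection g k G K) (α : SurfaceGroup g ≃* SurfaceGroup g) :
    IsGroupTrisection g k G (fun i => (K i).map α.toMonoidHom) := by
  have hsurj : Function.Surjective (α : SurfaceGroup g →* SurfaceGroup g) := α.surjective
  have himg : ∀ i, ((K i).map α.toMonoidHom : Set (SurfaceGroup g)) = α '' (K i) := fun i =>
    Subgroup.coe_map _ _
  have hnc : ∀ s : Set (SurfaceGroup g),
      (Subgroup.normalClosure s).map (α : SurfaceGroup g →* SurfaceGroup g) =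
        Subgroup.normalClosure (α '' s) := fun s =>
    Subgroup.map_normalClosure s _ hsurj
  refine ⟨fun i => (hK.normal i).map α.toMonoidHom α.surjective, fun i => ?_, fun i j hij => ?_, ?_⟩
  · refine (hK.free_quotient i).of_mulEquiv (QuotientGroup.congr _ _ α ?_)
    simp only [hnc, himg]
  · refine (hK.free_pairQuotient i j hij).of_mulEquiv (QuotientGroup.congr _ _ α ?_)
    simp only [hnc, himg, Set.image_union]
  · obtain ⟨e⟩ := hK.triple
    refine ⟨(QuotientGroup.congr _ _ α ?_).symm.trans e⟩
    simp only [hnc, himg, Set.image_iUnion]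

variable {m : ℕ}

/-- Transport of `Pairs` along `β ∈ Aut S`. -/
theorem pairs_transport (β : S m ≃* S m) {K : TrisectionKernels (3 + 3 * m)} (hW : Pairs m K) :
    Pairs m (fun i => (K i).map β.toMonoidHom) := by
  intro i j hij
  obtain ⟨α, hi, hj⟩ := hW i j hij
  exact ⟨α.trans β, by rw [map_trans, hi], by rw [map_trans, hj]⟩

/-- Transport of `Shadows` along `β ∈ Aut S` (characteristic subgroups are `Aut S`-invariant). -/
theorem shadows_transport (β : S m ≃* S m) {K : TrisectionKernels (3 + 3 * m)} (hS : Shadows m K) :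
    Shadows m (fun i => (K i).map β.toMonoidHom) := by
  intro M hM hMf
  obtain ⟨ψ, hψ⟩ := hS M hM hMf
  refine ⟨ψ.trans β, fun i => ?_⟩
  rw [map_trans, hψ i, Subgroup.map_sup, (Subgroup.characteristic_iff_map_eq.mp hM) β]

/-- Transport of the conclusion: `N ≅ β⁻¹ • K` implies `N ≅ K`. -/
theorem iso_transport (β : S m ≃* S m) {K : TrisectionKernels (3 + 3 * m)}
    (h : TrisectionKernels.Iso (N m) (fun i => (K i).map β.symm.toMonoidHom)) :
    TrisectionKernels.Iso (N m) K := by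
  obtain ⟨α, hα⟩ := h
  refine ⟨α.trans β, fun i => ?_⟩
  rw [map_trans, hα i]
  exact map_symm_map β (K i)

/-- Non-vacuity of the level notion: the standard triple has the identity as level-`c` solution. -/
theorem levelSolution_std (m c : ℕ) : LevelSolution m c (N m) :=
  ⟨MulEquiv.refl _, by simp, by simp, by simp⟩

/-! ## 1. ABELIAN LEVEL, arithmetic half: genus = class for the Lagrangian triple (ArithGate₀)

Stub 1 · `stub_abelianGenusClass` · for a slot-normalised `(3+3m; m+1)` group trisection
`K = (N 0, N 1, K 2)` of `{1}` with standard pairs and standard characteristic finite shadows there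
is `φ ∈ Aut S` stabilising `N 0·[S,S]` and `N 1·[S,S]` (i.e. `φ̄ ∈ Stab_{Sp±(2g,ℤ)}(L₀, L₁)`,
`L_i = N i·[S,S]/[S,S] ⊂ H = ℤ^{2g}`, `g = 3k`, `k = m+1`) with `φ(N 2)·[S,S] = K 2·[S,S]`
(`φ̄ L₂ = L₂'`). MECHANISM (card §(2)–(3), re-traced by triage r1-2/r1-3 N4): `hS` at the levels
`M_n = [S,S]·Sⁿ` gives `ψ̄_n ∈ Sp±(2g,ℤ)` fixing `L₀, L₁` and moving `L₂ ↦ L₂'` modulo `n`; by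
compactness one `Θ ∈ Sp±(2g,Ẑ) = cl Γ₀` with `Θ L̂ᵢ = L̂ᵢ'` — the triple `(L₀,L₁,L₂')` is in the
GENUS of `(L₀,L₁,L₂)` for `P = Stab(V₀,V₁)`; rationally `L₂' ∈ P(ℚ)·L₂` since
`ker[H¹(ℚ,𝕊₀) → H¹(ℚ,P)] = 0` (`𝕊₀ = Stab(V₀,V₁,L₂) = GL_k³ ⋉ U`, `U` = symmetric off-diagonal
shears, split: Hilbert 90); genus = class because the class number
`h(𝕊₀) = |𝕊₀(ℚ)\𝕊₀(𝔸_f)/𝕊₀(Ẑ)| = 1` (`h_ℚ = 1`, `GL_k(𝔸_f) = GL_k(ℚ)GL_k(Ẑ)`, strong approximation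
for `U`; the planner's `Ẑˣ`-units — route NUMBERS, `det = 2` on `L₀ ⊗ 𝔽_ℓ` — lie in the torus
`T(Ẑ) ⊂ 𝕊₀(Ẑ)` and are ABSORBED). `k = 1` checked by hand by both triagers. WHY IT MIGHT FAIL: for
`k ≥ 2` the component group / integral structure of `𝕊₀` must be re-derived (`π₀` beyond the
anti-symplectic `ℤ/2`, `Ш¹` of a finite constant group); the statement is implied by the crux, so a
refutation is a non-standard trisection of a homotopy 4-sphere seen by LINEAR algebra — none known
(FKSZ arXiv:1711.04762). Size L (Lean: `H₁(S_g) ≅ ℤ^{2g}` for `PresentedGroup`, `im(Aut S) = Sp±`,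
adelic/`Ẑ` compactness or an equivalent integral normal-form argument). Sources: Borel–Godement
(book:borel2020 Thm 5/6), GrunewaldPickelSegal1980 doi:10.2307/1971220, Serre *Galois Cohomology*
I §5, FellerEtAl2017. -/
def AbelianGenusClass : Prop :=
  ∀ (m : ℕ) (K : TrisectionKernels (3 + 3 * m)),
    IsGroupTrisection (3 + 3 * m) (m + 1) (PUnit : Type) K → K 0 = N m 0 → K 1 = N m 1 →
    Pairs m K → Shadows m K →
    ∃ φ : S m ≃* S m,
      (N m 0 ⊔ γ m 0).map φ.toMonoidHom = N m 0 ⊔ γ m 0 ∧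
      (N m 1 ⊔ γ m 0).map φ.toMonoidHom = N m 1 ⊔ γ m 0 ∧
      (N m 2 ⊔ γ m 0).map φ.toMonoidHom = K 2 ⊔ γ m 0

/-! ## 2. ABELIAN LEVEL, Goeritz half: level-0 Goeritz surjectivity (GS₀)

Stub 2 · `stub_goeritzAbelianImage` · every automorphism `φ` of `S` whose action on
`H = S/[S,S]` stabilises the two standard Lagrangians `L₀ = N 0·[S,S]/[S,S]`, `L₁` is CONGRUENT
modulo `[S,S]` to a Goeritz element: some `x ∈ A∩B` (`x(N 0) = N 0`, `x(N 1) = N 1`) with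
`x ≡ φ (mod [S,S])` pointwise — i.e. `im(A∩B → Sp±(2g,ℤ)) = Stab_{im Aut S}(L₀,L₁)`, the
(extended) Goeritz group of the standard genus-`3k` Heegaard splitting `(H₀,H₁)` of `#ᵏ S¹×S²`
realises the whole arithmetic pair-stabiliser `(GL_k × GL_{2k}) ⋉ Heis ⋊ ℤ/2` (card GS₀; the
14594 disprover's `levelOne_note` needs the same surjectivity). A statement about the STANDARD pair
alone (no 4-d content). Plausible: generators of the pair-stabiliser are realised by explicit
homeomorphisms — slides/permutations/`Aut F_k` of the `S¹×S²` summands (the `GL_k` block,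
Laudenbach), the genus-`2k` Goeritz group of `S³` on `(L₀+L₁)/(L₀∩L₁)` (the `GL_{2k}` block:
Powell generators, Scharlemann doi:10.56994/jamr.002.002.002, Zupan doi:10.1112/jlms.12272,
Freedman–Scharlemann genus 3), Dehn twists on curves bounding discs in both handlebodies and
"invisible slides" (the Heisenberg block), a reflection (the `ℤ/2`); `k = 1` checked on paper in
this seat's NOTES (partial hyperelliptic `= (−1) ⊕ I₄`, symmetric shear as an annulus twist). WHY IT
MIGHT FAIL: only through a mis-identified generator of the integral pair-stabiliser for `k ≥ 2`
(it needs generation of `Stab_{Sp(2g,ℤ)}(L₀,L₁)` by the listed elementary matrices, a finite check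
per block, not the Powell conjecture). Size M–L (Lean: explicit automorphisms of the one-relator
`PresentedGroup` preserving `⟪a_{3j}, a_{3j+1}, b_{3j+2}⟫`, `⟪a_{3j}, b_{3j+1}, a_{3j+2}⟫`, plus
the abelianisation dictionary shared with Stub 1). -/
def GoeritzAbelianImage : Prop :=
  ∀ (m : ℕ) (φ : S m ≃* S m),
    (N m 0 ⊔ γ m 0).map φ.toMonoidHom = N m 0 ⊔ γ m 0 →
    (N m 1 ⊔ γ m 0).map φ.toMonoidHom = N m 1 ⊔ γ m 0 →
    ∃ x : S m ≃* S m, (N m 0).map x.toMonoidHom = N m 0 ∧ (N m 1).map x.toMonoidHom = N m 1 ∧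
      ∀ s : S m, x s * (φ s)⁻¹ ∈ γ m 0

/-! ## 3. THE LAYER STEP: genus = class in the Johnson–Morita layer `γ_{c+2}/γ_{c+3}` (ArithGate_{c+1} ∧ GS_{c+1} on the fibre)

Stub 3 · `stub_nilpotentLayerStep` · for a slot-normalised `(3+3m; m+1)` group trisection `K` of
`{1}` with standard pairs and standard characteristic finite shadows whose slot `2` is ALREADY
standard modulo `γ_{c+2}` (`K 2·γ = N 2·γ`, `γ = γ m c`), some Goeritz element `y ∈ A∩B` makes it
standard modulo the next term: `y(N 2)·γ_{c+3} = K 2·γ_{c+3}`. MECHANISM (card §(1),(2),(4)): in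
`Λ_{c+1} = S/γ_{c+3}S` (f.g. torsion-free nilpotent, Labute) the images `N̄ᵢ`, `K̄₂` are
Malcev-closed normal subgroups (`Λ/K̄₂ = F_g/γ_{c+3}F_g` torsion-free) agreeing modulo the central
layer `Z = γ_{c+2}/γ_{c+3}`; `Γ_{c+1} = im(Aut S → Aut Λ_{c+1})` is arithmetic in
`𝔾_{c+1} = Sp± ⋉ 𝕌_{c+1}` and CONGRUENCE there (Bass–Milnor–Serre for `Sp_{2g}(ℤ)`, `g ≥ 3`, plus CSP
for f.g. nilpotent groups), `hS` restricted to `M·γ_{c+3}S` + compactness puts `K̄₂` in the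
`cl(Γ_{c+1}) ∩ Stab(N̄₀,N̄₁)`-genus of `N̄₂`, and genus = class follows from
`ker[H¹(ℚ,𝕊_{c+1}) → H¹(ℚ,P_{c+1})] = 0` and `h(𝕊_{c+1}, 𝕂 ∩ 𝕊_{c+1}(𝔸_f)) = 1`, where
`𝕊_{c+1} → 𝕊_c` is an extension of a ℚ-subgroup of `𝕊₀ = GL_k³ ⋉ U` by a vector group (the only
new phenomena: a non-split torus / finite component group with `Ш ≠ 0`, or units missing from `𝕂`
at the primes dividing `[𝕌(ℤ) : im Torelli]`, i.e. `2, 3` — Johnson/Morita/Birman–Craggs); then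
the Γ-level solution, which lies in `Stab_{Γ_{c+1}}(N̄₀,N̄₁)` and over the level-`c` trisection
group, is lifted to `A∩B` (GS_{c+1} ON THE FIBRE: the Goeritz analogue of Habiro–Massuyeau's
handlebody Johnson theory arXiv:2401.07705, Faes arXiv:2010.16268). Each instance `(m, c)` is a
DECIDABLE orbit problem for an arithmetic group (Grunewald–Segal 1980); the first one, `(m,c) =
(0,0)` (genus 3, layer `Λ³H ⊕ …`, `𝕊₁` from `τ₁(I₃) = Λ³H`, class number at `p = 2`), is the line's
cheapest falsifier (one exact-linear-algebra kit job, triage sharpening). WHY IT MIGHT FAIL: `h > 1`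
or `Ш ≠ 0` for some `𝕊_{c+1}` AND the extra genus class realised by a trisection of `{1}`; or GS on
the fibre fails (a level-stabiliser of `(N̄₀,N̄₁,N̄₂ mod γ_{c+2})` not liftable to `A∩B` modulo
`𝒥_{c+1}`) — the statement is implied by the crux (take `y :=` the Iso), so a refutation is again a
non-standard homotopy-sphere trisection, now seen by NILPOTENT data of class `c+1`. Size XL as a
`∀ c` statement (open-ended), L per layer. Sources: GrunewaldPickelSegal1980, Pickel1971
doi:10.2307/1995809, Bass–Milnor–Serre, Hain2008 arXiv:0802.0814 §10–11, HabiroMassuyeau2024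
arXiv:2401.07705, Morita 1993, Labute 1970. -/
def NilpotentLayerStep : Prop :=
  ∀ (m c : ℕ) (K : TrisectionKernels (3 + 3 * m)),
    IsGroupTrisection (3 + 3 * m) (m + 1) (PUnit : Type) K → K 0 = N m 0 → K 1 = N m 1 →
    Pairs m K → Shadows m K → K 2 ⊔ γ m c = N m 2 ⊔ γ m c →
    ∃ y : S m ≃* S m, (N m 0).map y.toMonoidHom = N m 0 ∧ (N m 1).map y.toMonoidHom = N m 1 ∧
      (N m 2 ⊔ γ m (c + 1)).map y.toMonoidHom = K 2 ⊔ γ m (c + 1)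

/-! ## 4. `c → ∞`: the Goeritz orbit of `N 2` is closed in the Johnson topology on the gate locus

Stub 4 · `stub_johnsonClosedGate` · a slot-normalised `(3+3m; m+1)` group trisection `K` of `{1}`
with standard pairs and standard characteristic finite shadows which admits a level-`c` solution
`x_c ∈ A∩B` (`x_c(N 2)·γ_{c+2} = K 2·γ_{c+2}`) for EVERY `c` is standard: `Iso N K`. Since
`S/K 2 ≅ F_g` is residually nilpotent, `⋂_c K 2·γ_{c+2} = K 2`, so ONE `x ∈ A∩B` solving all levels
gives `x(N 2) = K 2`; the content is the passage from level-wise solutions to a simultaneous one: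
an integral MITTAG-LEFFLER statement for the tower of cosets `x_c · G_c`,
`G_c = A∩B ∩ Stab(N 2·γ_{c+2})` (the level-`c` trisection groups of the STANDARD triple), the
pronilpotent twin of the route's congruence SEP (item 14596) — but in the one completion of `Mod_g`
where (i) there is no separability debt (`F_g` residually nilpotent), (ii) closures live in Hain's
relative completion, computable degree by degree (Hain 1997/2008; Habiro–Massuyeau 2024 for
handlebody groups), (iii) a 4-d input exists: Lambert-Cole arXiv:1901.10834 Thm 1.1 (trisections of
homeomorphic 4-manifolds differ by Johnson-kernel regluing) with `X_K ≈ S⁴` (Freedman). Attack plan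
(line card): (a) TS_c — `G_c = G_N · (A∩B ∩ 𝒥_c)` for `c ≥ c₀(m)`, the Johnson–Morita theory of the
TRISECTION group `G_N = A∩B∩C` (new object; makes the `x_c` a Johnson–Cauchy sequence);
(b) Lambert-Cole normalisation of `x_c` into `𝒥_c`; (c) Hain's non-density bounds on
`cl(A∩B)·cl(C) ∩ Mod_g` versus `(A∩B)·C`. HONEST RESIDUAL: given Stubs 1–3 it is equivalent to the
crux, hence on the load path to `SPC4_g ∧` balanced 4-d Waldhausen_g (Disproof §2); it is NOT the
crux verbatim at any `m` (its extra hypothesis consumes `hS` non-trivially at every genus, unlike the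
vacuous Nielsen level of `free-shadow-tsystem` at `m = 0`), and it is FALSE without
`IsGroupTrisection ∧ Pairs` (`johnsonClosedGate_false_without_isGroupTrisection` below: the junk
triple has `x_c = id` for all `c`). Size: open-problem. Sources: Hain2008 arXiv:0802.0814,
LambertCole2020 arXiv:1901.10834, HabiroMassuyeau2024 arXiv:2401.07705, MeierSchirmerZupan2016,
AbramsGayKirby2018. -/
def JohnsonClosedGate : Prop :=
  ∀ (m : ℕ) (K : TrisectionKernels (3 + 3 * m)),
    IsGroupTrisection (3 + 3 * m) (m + 1) (PUnit : Type) K → K 0 = N m 0 → K 1 = N m 1 →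
    Pairs m K → Shadows m K → (∀ c : ℕ, LevelSolution m c K) →
    TrisectionKernels.Iso (N m) K

/-! ## Registered stubs -/

/-- STUB 1 (ArithGate₀; size L; provable now on paper for `k = 1`, genre-classical for all `k`). -/
theorem stub_abelianGenusClass : AbelianGenusClass := by
  sorry

/-- STUB 2 (GS₀; size M–L; classical-type statement about the standard Heegaard pair). -/
theorem stub_goeritzAbelianImage : GoeritzAbelianImage := by
  sorry

/-- STUB 3 (layer step; size XL as `∀ c`, L per layer; each instance decidable; first instance
`(m,c) = (0,0)` is the cheapest falsifier). -/
theorem stub_nilpotentLayerStep : NilpotentLayerStep := by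
  sorry

/-- STUB 4 (Johnson-closed gate; the LOAD-BEARING residual, open-problem). -/
theorem stub_johnsonClosedGate : JohnsonClosedGate := by
  sorry

/-! ## 5. Composition (sorry-free glue) -/

/-- **All levels from the abelian level and the layer step** (induction on `c`, transporting `K`
along the level-`c` solution before applying the step and composing afterwards). -/
theorem levelSolution_all (h₁ : AbelianGenusClass) (h₂ : GoeritzAbelianImage)
    (h₃ : NilpotentLayerStep) (m : ℕ) :
    ∀ (c : ℕ) (K : TrisectionKernels (3 + 3 * m)),
      IsGroupTrisection (3 + 3 * m) (m + 1) (PUnit : Type) K → K 0 = N m 0 → K 1 = N m 1 →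
      Pairs m K → Shadows m K → LevelSolution m c K := by
  intro c
  induction c with
  | zero =>
    intro K hK h0 h1 hW hS
    -- arithmetic: genus = class at the abelian level
    obtain ⟨φ, hφ0, hφ1, hφ2⟩ := h₁ m K hK h0 h1 hW hS
    -- Goeritz: lift `φ̄ ∈ Stab(L₀,L₁)` to `x ∈ A∩B`, `x ≡ φ (mod [S,S])`
    obtain ⟨x, hx0, hx1, hcong⟩ := h₂ m φ hφ0 hφ1
    refine ⟨x, hx0, hx1, ?_⟩
    rw [Subgroup.map_sup, map_γ] at hφ2
    rw [Subgroup.map_sup, map_γ, map_sup_congr hcong, hφ2]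
  | succ c ih =>
    intro K hK h0 h1 hW hS
    obtain ⟨x, hx0, hx1, hx2⟩ := ih K hK h0 h1 hW hS
    -- transport `K` along `x⁻¹`: slot 2 becomes standard modulo `γ m c`
    have hK' : IsGroupTrisection (3 + 3 * m) (m + 1) (PUnit : Type)
        (fun i => (K i).map x.symm.toMonoidHom) := isGroupTrisection_map hK x.symm
    have h0' : (fun i => (K i).map x.symm.toMonoidHom) 0 = N m 0 := by
      show (K 0).map x.symm.toMonoidHom = N m 0
      rw [h0]
      exact map_symm_of_map x hx0
    have h1' : (fun i => (K i).map x.symm.toMonoidHom) 1 = N m 1 := by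
      show (K 1).map x.symm.toMonoidHom = N m 1
      rw [h1]
      exact map_symm_of_map x hx1
    have h2' : (fun i => (K i).map x.symm.toMonoidHom) 2 ⊔ γ m c = N m 2 ⊔ γ m c := by
      show (K 2).map x.symm.toMonoidHom ⊔ γ m c = N m 2 ⊔ γ m c
      have e := congrArg (Subgroup.map x.symm.toMonoidHom) hx2
      rw [map_map_symm, Subgroup.map_sup, map_γ] at e
      exact e.symm
    -- the layer step on the transported triple
    obtain ⟨y, hy0, hy1, hy2⟩ :=
      h₃ m c _ hK' h0' h1' (pairs_transport x.symm hW) (shadows_transport x.symm hS) h2'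
    have hy2' : (N m 2 ⊔ γ m (c + 1)).map y.toMonoidHom =
        (K 2).map x.symm.toMonoidHom ⊔ γ m (c + 1) := hy2
    -- compose: `x ∘ y`
    refine ⟨y.trans x, ?_, ?_, ?_⟩
    · rw [map_trans, hy0, hx0]
    · rw [map_trans, hy1, hx1]
    · rw [map_trans, hy2', Subgroup.map_sup, map_γ, map_symm_map]

/-- **The slot-normalised crux from the four parts** (pure logic): all levels, then the
Johnson-closed gate. -/
theorem normalised_of_parts (h₁ : AbelianGenusClass) (h₂ : GoeritzAbelianImage)
    (h₃ : NilpotentLayerStep) (h₄ : JohnsonClosedGate) (m : ℕ) (K : TrisectionKernels (3 + 3 * m))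
    (hK : IsGroupTrisection (3 + 3 * m) (m + 1) (PUnit : Type) K) (h0 : K 0 = N m 0)
    (h1 : K 1 = N m 1) (hW : Pairs m K) (hS : Shadows m K) : TrisectionKernels.Iso (N m) K :=
  h₄ m K hK h0 h1 hW hS fun c => levelSolution_all h₁ h₂ h₃ m c K hK h0 h1 hW hS

/-- **The crux from the four parts, as an implication** (pure logic, kernel-checked): normalise
slots `0, 1` with the automorphism supplied by the crux's own hypothesis `hW 0 1` (transporting
`IsGroupTrisection`, `Pairs`, `Shadows` along `α⁻¹`), apply `normalised_of_parts`, undo `α`.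
(Stated with conclusion `Iso`, so that `ShadowApproximation_of` below is the unique theorem of this
file concluding the crux by name.) -/
theorem iso_of_parts (h₁ : AbelianGenusClass) (h₂ : GoeritzAbelianImage)
    (h₃ : NilpotentLayerStep) (h₄ : JohnsonClosedGate) :
    ∀ (m : ℕ) (K : TrisectionKernels (3 + 3 * m)),
      IsGroupTrisection (3 + 3 * m) (m + 1) (PUnit : Type) K → Pairs m K → Shadows m K →
        TrisectionKernels.Iso (N m) K := by
  intro m K hK hW hS
  obtain ⟨α, hα0, hα1⟩ := hW 0 1 (by decide)
  exact iso_transport α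
    (normalised_of_parts h₁ h₂ h₃ h₄ m (fun i => (K i).map α.symm.toMonoidHom)
      (isGroupTrisection_map hK α.symm) (map_symm_of_map α hα0) (map_symm_of_map α hα1)
      (pairs_transport α.symm hW) (shadows_transport α.symm hS))

/-- **Composition.** The four registered stubs prove the crux `CongruenceShadows.ShadowApproximation`
BY NAME. -/
theorem ShadowApproximation_of :
    _root_.Summit.SmoothPoincare4.SmoothPoincare4.Theses.CongruenceShadows.ShadowApproximation :=
  fun m K hK hW hS => iso_of_parts stub_abelianGenusClass stub_goeritzAbelianImage
    stub_nilpotentLayerStep stub_johnsonClosedGate m K hK hW hS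

/-! ## 6. Certificates (sorry-free): Disproof §3 honoured — Stub 4 needs `IsGroupTrisection ∧ Pairs`

The landed junk triple `J = (N₀, N₁, J₂)`, `J₂ = N₂ ⊓ ker θ` (`Negative/ShadowsOnlyFalse.lean`,
p73171) has standard NILPOTENT shadows at every level with the identity as level solution: since
`θ[s_h, b₀] = h c h⁻¹ c⁻¹ = c = θ b₀` with `s_h ∈ N₂`, the generator `b₀` lies in `⁅N₂,N₂⁆·J₂`
(and `a₁, a₂ ∈ J₂`), so `N₂ ≤ ⁅N₂,N₂⁆·J₂`, i.e. `N₂/J₂` is perfect, hence `N₂ ≤ J₂·γₙS` for every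
`n`. So `J` satisfies every hypothesis of `JohnsonClosedGate` except `IsGroupTrisection` / `Pairs`
(it violates exactly `free_quotient 2`, `free_pairQuotient 0 2`: `ShadowsOnlyFalseFields`, p73918),
and `¬ Iso N J`: the residual stub is false without them, and any proof of it must use the freeness
of `S/K 2` (residual nilpotence of `F_g` is where the line uses it). -/

section junk

open scoped commutatorElement

open Summit.SmoothPoincare4.SmoothPoincare4.Theorems.ShadowApproximation.Negative
  (theta thetaGen theta_of sh cyc hPerm J2 junk theta_b0 theta_sh hPerm_mul_cyc b0_mem_N2 J2_le
    not_iso_junk junk_normal junk_shadows)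

/-- `s_h ∈ N₂` (a product of conjugates of `b₀ ∈ N₂`). -/
theorem sh_mem_N2 : sh ∈ s4Kernels 2 := by
  have hb := b0_mem_N2
  have n : (s4Kernels 2).Normal := inferInstance
  rw [sh]
  refine Subgroup.mul_mem _ (Subgroup.mul_mem _ ?_ ?_) hb
  · have := n.conj_mem _ hb ((SurfaceGroup.b 1)⁻¹ * (SurfaceGroup.b 1)⁻¹)
    simpa [mul_assoc] using this
  · have := n.conj_mem _ hb ((SurfaceGroup.b 1)⁻¹)
    simpa [mul_assoc] using this

/-- `θ[s_h, b₀] = θ b₀`: the 3-cycle `(0 1 2)` is a commutator inside `θ(N₂)`. -/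
theorem theta_comm_sh_b0 :
    theta ⁅sh, (SurfaceGroup.b 0 : SurfaceGroup 3)⁆ = theta (SurfaceGroup.b 0) := by
  rw [commutatorElement_def, map_mul, map_mul, map_mul, map_inv, map_inv, theta_sh, theta_b0,
    hPerm_mul_cyc]
  simp [mul_assoc]

/-- `b₀ ∈ ⁅N₂,N₂⁆ ⊔ J₂`. -/
theorem b0_mem_commutator_sup_J2 :
    SurfaceGroup.b 0 ∈ ⁅s4Kernels 2, s4Kernels 2⁆ ⊔ J2 := by
  have hc : ⁅sh, (SurfaceGroup.b 0 : SurfaceGroup 3)⁆ ∈ ⁅s4Kernels 2, s4Kernels 2⁆ :=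
    Subgroup.commutator_mem_commutator sh_mem_N2 b0_mem_N2
  have hcN : ⁅sh, (SurfaceGroup.b 0 : SurfaceGroup 3)⁆ ∈ s4Kernels 2 :=
    Subgroup.commutator_le_right (s4Kernels 2) (s4Kernels 2) hc
  have hj : (⁅sh, (SurfaceGroup.b 0 : SurfaceGroup 3)⁆)⁻¹ * SurfaceGroup.b 0 ∈ J2 := by
    refine Subgroup.mem_inf.2 ⟨Subgroup.mul_mem _ (Subgroup.inv_mem _ hcN) b0_mem_N2, ?_⟩
    rw [MonoidHom.mem_ker, map_mul, map_inv, theta_comm_sh_b0, inv_mul_cancel]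
  have e : SurfaceGroup.b 0 =
      ⁅sh, (SurfaceGroup.b 0 : SurfaceGroup 3)⁆ *
        ((⁅sh, (SurfaceGroup.b 0 : SurfaceGroup 3)⁆)⁻¹ * SurfaceGroup.b 0) := by
    rw [mul_inv_cancel_left]
  rw [e]
  exact Subgroup.mul_mem_sup hc hj

/-- `N₂ ≤ ⁅N₂,N₂⁆ ⊔ J₂`, i.e. `N₂/J₂ (≅ θ(N₂) = Alt_fin ℤ)` is perfect — checked on the three normal
generators `b₀, a₁, a₂` of `N₂`. -/
theorem N2_le_commutator_sup_J2 : s4Kernels 2 ≤ ⁅s4Kernels 2, s4Kernels 2⁆ ⊔ J2 := by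
  have key : Subgroup.normalClosure (PresentedGroup.of '' (s4Gens 2 : Set (surfaceGen 3))) ≤
      ⁅s4Kernels 2, s4Kernels 2⁆ ⊔ J2 := by
    refine Subgroup.normalClosure_le_normal ?_
    rintro _ ⟨p, hp, rfl⟩
    have hp' : p ∈ s4Gens 2 := hp
    have hgen : ∀ q : surfaceGen 3, q ∈ s4Gens 2 → thetaGen q = 1 →
        (PresentedGroup.of q : SurfaceGroup 3) ∈ ⁅s4Kernels 2, s4Kernels 2⁆ ⊔ J2 := by
      intro q hq hθ
      refine Subgroup.mem_sup_right (Subgroup.mem_inf.2 ⟨of_mem_s4Kernels 2 hq, ?_⟩)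
      rw [MonoidHom.mem_ker, theta_of, hθ]
    obtain ⟨i, b⟩ := p
    fin_cases i <;> cases b <;>
      first
      | exact absurd hp' (by decide)
      | exact b0_mem_commutator_sup_J2
      | exact hgen _ hp' (by simp [thetaGen])
  exact le_trans (le_of_eq (s4Kernels_eq 2)) key

/-- `N₂ ≤ J₂ ⊔ γₙ(S₃)` for every `n`: a perfect section lies in every term of the lower central
series (computed in `S₃ ⧸ J₂` and pulled back). -/
theorem N2_le_J2_sup_lcs (n : ℕ) :
    s4Kernels 2 ≤ J2 ⊔ (⊤ : Subgroup (SurfaceGroup 3)).lowerCentralSeries n := by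
  have hsurj : Function.Surjective (QuotientGroup.mk' J2) := QuotientGroup.mk'_surjective J2
  -- the image `P` of `N₂` in `S ⧸ J₂` is perfect
  have hP : (s4Kernels 2).map (QuotientGroup.mk' J2) ≤
      ⁅(s4Kernels 2).map (QuotientGroup.mk' J2), (s4Kernels 2).map (QuotientGroup.mk' J2)⁆ := by
    have := Subgroup.map_mono (f := QuotientGroup.mk' J2) N2_le_commutator_sup_J2
    rwa [Subgroup.map_sup, Subgroup.map_commutator, QuotientGroup.map_mk'_self, sup_bot_eq] at this
  -- hence inside every term of the lower central series of the quotient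
  have hlcs : ∀ k, (s4Kernels 2).map (QuotientGroup.mk' J2) ≤
      (⊤ : Subgroup (SurfaceGroup 3 ⧸ J2)).lowerCentralSeries k := by
    intro k
    induction k with
    | zero => exact le_top
    | succ k ih =>
      rw [Subgroup.lowerCentralSeries_succ]
      exact hP.trans (Subgroup.commutator_mono ih le_top)
  -- pull back along `S ↠ S ⧸ J₂`
  have h1 : s4Kernels 2 ≤
      (((⊤ : Subgroup (SurfaceGroup 3)).lowerCentralSeries n).map (QuotientGroup.mk' J2)).comap
        (QuotientGroup.mk' J2) := by
    rw [Subgroup.map_lowerCentralSeries, Subgroup.map_top_of_surjective _ hsurj]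
    exact fun x hx => Subgroup.mem_comap.2 (hlcs n (Subgroup.mem_map_of_mem _ hx))
  rw [Subgroup.comap_map_eq, QuotientGroup.ker_mk', sup_comm] at h1
  exact h1

/-- **The junk triple has the identity as level-`c` solution for every `c`** (standard nilpotent
shadows at all levels, exact slots `0, 1`). -/
theorem junk_levelSolution (c : ℕ) : LevelSolution 0 c junk := by
  refine ⟨MulEquiv.refl _, by simp, by simp, ?_⟩
  have e : (N 0 2 ⊔ γ 0 c).map (MulEquiv.refl (S 0)).toMonoidHom = N 0 2 ⊔ γ 0 c := by simp
  rw [e]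
  show s4Kernels 2 ⊔ γ 0 c = J2 ⊔ γ 0 c
  exact le_antisymm (sup_le (N2_le_J2_sup_lcs (c + 1)) le_sup_right) (sup_le_sup_right J2_le _)

/-- **Disproof §3 at Stub 4: `JohnsonClosedGate` is FALSE without `IsGroupTrisection ∧ Pairs`.**
Keeping normality of the kernels, the literal slot normalisation, the shadow hypothesis VERBATIM and
level solutions at EVERY nilpotent level, `Iso` still fails (junk triple, `m = 0`). -/
theorem johnsonClosedGate_false_without_isGroupTrisection :
    ¬ ∀ (m : ℕ) (K : TrisectionKernels (3 + 3 * m)), (∀ i, (K i).Normal) → K 0 = N m 0 →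
      K 1 = N m 1 → Shadows m K → (∀ c : ℕ, LevelSolution m c K) →
      TrisectionKernels.Iso (N m) K := by
  intro h
  refine not_iso_junk (h 0 junk junk_normal rfl rfl (fun M hM hF => ⟨MulEquiv.refl _, fun i => ?_⟩)
    junk_levelSolution)
  haveI := hM
  haveI := hF
  haveI : M.Normal := inferInstance
  change (s4Kernels i ⊔ M).map (MulEquiv.refl (SurfaceGroup 3)).toMonoidHom = junk i ⊔ M
  simpa using junk_shadows M i

end junk

end Summit.SmoothPoincare4.SmoothPoincare4.Cruxes.ShadowApproximation.NilpotentGenusClass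

end
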